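import Summits.QuantumFields.YangMills.Theorems.SmallCircleAnchorAnchorGapPolyGrowthClass
import Summits.QuantumFields.YangMills.Theorems.SmallCircleAnchorAnchorGapStubDebyeScreening18

/-!
# Crux `AnchorGap` (stmt-QuantumFields-11141), line `registered` — the heat sum IS GREP's line operator
# `Dop`, and the observable class is stable under `Dop` (step (G2) of the assembly of GREP, part 3)

Bookkeeping between ✓HEAT's output `½ Σ_{ab} (B_ℓ)_{ab} E(M)(∂_b∂_a H)` (as produced by
`LineDeriv.fderiv_gaussExpect_cov_single`) and GREP's line operator
`Dop ℓ H φ = ½ Σ_{x,y : {blk x, blk y} = ℓ, blk x ≠ blk y} C_{xy} · D²H(φ)(e_x, e_y)`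
(`stub_gaussianBBFPolymerRep`): for a line `ℓ = {p, q}` of atoms of `X` they have the same normalised
expectation under any positive definite covariance (`heatSum_eq_gaussExpect_dop`: linearity of the
Gaussian expectation over the finite sum, ✓`integrable_polyGrowth_mul_gaussian`, symmetry of `B_ℓ` and
✓`PolyGrowth.fderiv_partial_apply`), and `Dop ℓ H` is again in the smooth polynomial-growth class
(`dop_contDiff`, `dop_mem_class`).  [folklore]; no definition, no named fact.
-/

set_option autoImplicit false

namespace Summit.QuantumFields.YangMills.Theorems.AnchorGap.LineDop

open Finset MeasureTheory
open scoped Matrix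

variable {ι β : Type} [Fintype ι] [DecidableEq ι] [DecidableEq β]

omit [Fintype ι] [DecidableEq ι] [DecidableEq β] in
/-- For a line `ℓ = {p, q}` of atoms of `X`, the direction-matrix condition is GREP's `Dop` condition.
[folklore] -/
theorem dir_cond_iff (blk : ι → β) (X : Finset β) {p q : β} (hp : p ∈ X) (hq : q ∈ X) (x y : ι) :
    (¬ blk x = blk y ∧ (blk x ∈ X ∧ blk y ∈ X) ∧ s(blk x, blk y) = s(p, q))
      ↔ (s(blk x, blk y) = s(p, q) ∧ blk x ≠ blk y) := by
  constructor
  · rintro ⟨h1, -, h3⟩; exact ⟨h3, h1⟩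
  · rintro ⟨h3, h1⟩
    refine ⟨h1, ?_, h3⟩
    rcases Sym2.eq_iff.1 h3 with ⟨ha, hb⟩ | ⟨ha, hb⟩
    · exact ⟨ha ▸ hp, hb ▸ hq⟩
    · exact ⟨ha ▸ hq, hb ▸ hp⟩

/-- `Dop ℓ H` is smooth for smooth `H`. [folklore] -/
theorem dop_contDiff (blk : ι → β) (C : Matrix ι ι ℝ) (ℓ : Sym2 β) {H : (ι → ℝ) → ℝ}
    (hH : ContDiff ℝ (⊤ : ℕ∞) H) :
    ContDiff ℝ (⊤ : ℕ∞) (fun φ : ι → ℝ => (1 / 2 : ℝ) * ∑ x : ι, ∑ y : ι,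
      if s(blk x, blk y) = ℓ ∧ blk x ≠ blk y
        then C x y * iteratedFDeriv ℝ 2 H φ ![Pi.single x 1, Pi.single y 1] else 0) := by
  refine contDiff_const.mul (ContDiff.sum fun x _ => ContDiff.sum fun y _ => ?_)
  by_cases h : s(blk x, blk y) = ℓ ∧ blk x ≠ blk y
  · simp only [if_pos h]
    have h2 : ContDiff ℝ (⊤ : ℕ∞) (fun φ : ι → ℝ =>
        fderiv ℝ (fun φ : ι → ℝ => fderiv ℝ H φ (Pi.single y 1)) φ (Pi.single x 1)) :=
      PolyGrowth.contDiff_partial (PolyGrowth.contDiff_partial hH _) _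
    have heq : (fun φ : ι → ℝ => iteratedFDeriv ℝ 2 H φ ![Pi.single x 1, Pi.single y 1])
        = fun φ => fderiv ℝ (fun φ : ι → ℝ => fderiv ℝ H φ (Pi.single y 1)) φ (Pi.single x 1) := by
      funext φ; rw [PolyGrowth.fderiv_partial_apply hH]
    rw [show (fun φ : ι → ℝ => C x y * iteratedFDeriv ℝ 2 H φ ![Pi.single x 1, Pi.single y 1])
      = fun φ => C x y * fderiv ℝ (fun φ : ι → ℝ => fderiv ℝ H φ (Pi.single y 1)) φ (Pi.single x 1)
      from by funext φ; rw [PolyGrowth.fderiv_partial_apply hH]]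
    exact contDiff_const.mul h2
  · simp only [if_neg h]; exact contDiff_const

omit [DecidableEq ι] [DecidableEq β] in
/-- Norm of the derivatives of a finite sum. [folklore] -/
theorem norm_iteratedFDeriv_sum_le {κ : Type} (S : Finset κ) {f : κ → (ι → ℝ) → ℝ} {n : ℕ}
    (hf : ∀ j ∈ S, ContDiff ℝ n (f j)) (φ : ι → ℝ) :
    ‖iteratedFDeriv ℝ n (fun φ : ι → ℝ => ∑ j ∈ S, f j φ) φ‖ ≤ ∑ j ∈ S, ‖iteratedFDeriv ℝ n (f j) φ‖ := by
  rw [iteratedFDeriv_sum hf, Finset.sum_apply]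
  exact norm_sum_le _ _

omit [DecidableEq ι] [DecidableEq β] in
/-- Norm of the derivatives of a constant multiple. [folklore] -/
theorem norm_iteratedFDeriv_const_mul (c : ℝ) {f : (ι → ℝ) → ℝ} {n : ℕ} (hf : ContDiff ℝ n f)
    (φ : ι → ℝ) :
    ‖iteratedFDeriv ℝ n (fun φ : ι → ℝ => c * f φ) φ‖ = |c| * ‖iteratedFDeriv ℝ n f φ‖ := by
  rw [show (fun φ : ι → ℝ => c * f φ) = c • f from rfl,
    iteratedFDeriv_const_smul_apply (a := c) hf.contDiffAt, norm_smul, Real.norm_eq_abs]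

/-- **The class is stable under `Dop ℓ`**: all derivatives of `Dop ℓ H` have polynomial growth.
[folklore] -/
theorem dop_mem_class (blk : ι → β) (C : Matrix ι ι ℝ) (ℓ : Sym2 β) {H : (ι → ℝ) → ℝ}
    (hH : ContDiff ℝ (⊤ : ℕ∞) H)
    (hb : ∀ n : ℕ, ∃ (K : ℝ) (m : ℕ), ∀ φ : ι → ℝ, ‖iteratedFDeriv ℝ n H φ‖ ≤ K * (1 + ∑ i, φ i ^ 2) ^ m)
    (n : ℕ) :
    ∃ (K : ℝ) (m : ℕ), ∀ φ : ι → ℝ, ‖iteratedFDeriv ℝ n (fun φ : ι → ℝ => (1 / 2 : ℝ) * ∑ x : ι, ∑ y : ι,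
      if s(blk x, blk y) = ℓ ∧ blk x ≠ blk y
        then C x y * iteratedFDeriv ℝ 2 H φ ![Pi.single x 1, Pi.single y 1] else 0) φ‖
      ≤ K * (1 + ∑ i, φ i ^ 2) ^ m := by
  obtain ⟨K, m, hK⟩ := hb (n + 2)
  -- the second partials and their coefficients
  set dd : ι → ι → (ι → ℝ) → ℝ := fun x y φ =>
    fderiv ℝ (fun φ : ι → ℝ => fderiv ℝ H φ (Pi.single y 1)) φ (Pi.single x 1) with hdd
  set c : ι → ι → ℝ := fun x y => if s(blk x, blk y) = ℓ ∧ blk x ≠ blk y then C x y else 0 with hc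
  have hddc : ∀ x y, ContDiff ℝ (⊤ : ℕ∞) (dd x y) := fun x y =>
    PolyGrowth.contDiff_partial (PolyGrowth.contDiff_partial hH _) _
  have hddn : ∀ x y, ContDiff ℝ n (dd x y) := fun x y => (hddc x y).of_le (by exact_mod_cast le_top)
  have hddb : ∀ x y φ, ‖iteratedFDeriv ℝ n (dd x y) φ‖ ≤ K * (1 + ∑ i, φ i ^ 2) ^ m := by
    intro x y φ
    have h1 := PolyGrowth.norm_iteratedFDeriv_partial_le (PolyGrowth.contDiff_partial hH (Pi.single y 1))
      (Pi.single x 1) n φ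
    have h2 := PolyGrowth.norm_iteratedFDeriv_partial_le hH (Pi.single y 1) (n + 1) φ
    have hx := PolyGrowth.norm_single_le_one (ι := ι) x
    have hy := PolyGrowth.norm_single_le_one (ι := ι) y
    have hpos : 0 ≤ ‖iteratedFDeriv ℝ (n + 1 + 1) H φ‖ := norm_nonneg _
    refine h1.trans ?_
    calc ‖(Pi.single x (1:ℝ) : ι → ℝ)‖ * ‖iteratedFDeriv ℝ (n + 1) (fun φ : ι → ℝ => fderiv ℝ H φ (Pi.single y 1)) φ‖
        ≤ 1 * (1 * ‖iteratedFDeriv ℝ (n + 1 + 1) H φ‖) :=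
          mul_le_mul hx (h2.trans (mul_le_mul_of_nonneg_right hy hpos)) (norm_nonneg _) zero_le_one
      _ = ‖iteratedFDeriv ℝ (n + 2) H φ‖ := by ring_nf
      _ ≤ K * (1 + ∑ i, φ i ^ 2) ^ m := hK φ
  -- rewrite the operator with `dd` and `c`
  have hfun : (fun φ : ι → ℝ => (1 / 2 : ℝ) * ∑ x : ι, ∑ y : ι,
      if s(blk x, blk y) = ℓ ∧ blk x ≠ blk y
        then C x y * iteratedFDeriv ℝ 2 H φ ![Pi.single x 1, Pi.single y 1] else 0)
      = fun φ => (1 / 2 : ℝ) * ∑ x : ι, (fun φ => ∑ y : ι, c x y * dd x y φ) φ := by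
    funext φ
    congr 1
    refine Finset.sum_congr rfl fun x _ => Finset.sum_congr rfl fun y _ => ?_
    simp only [hc, hdd]
    split_ifs with h
    · rw [PolyGrowth.fderiv_partial_apply hH]
    · rw [zero_mul]
  have hrow : ∀ x, ContDiff ℝ n (fun φ : ι → ℝ => ∑ y : ι, c x y * dd x y φ) := fun x =>
    ContDiff.sum fun y _ => contDiff_const.mul (hddn x y)
  refine ⟨(1 / 2 : ℝ) * ∑ x : ι, ∑ y : ι, |C x y| * K, m, fun φ => ?_⟩
  rw [hfun, norm_iteratedFDeriv_const_mul _ (ContDiff.sum fun x _ => hrow x),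
    abs_of_pos (by norm_num : (0 : ℝ) < 1 / 2), mul_assoc, Finset.sum_mul]
  refine mul_le_mul_of_nonneg_left ?_ (by norm_num)
  refine (norm_iteratedFDeriv_sum_le _ (fun x _ => hrow x) φ).trans (Finset.sum_le_sum fun x _ => ?_)
  rw [Finset.sum_mul]
  refine (norm_iteratedFDeriv_sum_le _ (fun y _ => contDiff_const.mul (hddn x y)) φ).trans
    (Finset.sum_le_sum fun y _ => ?_)
  rw [norm_iteratedFDeriv_const_mul _ (hddn x y), mul_assoc]
  refine mul_le_mul ?_ (hddb x y φ) (norm_nonneg _) (abs_nonneg _)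
  simp only [hc]
  split_ifs <;> simp

/-- **The heat sum is the expectation of `Dop ℓ H`.** For a positive definite covariance `M`, a line
`ℓ = {p, q}` of atoms of `X` and `H` of the class:
`½ Σ_{ab} (B_ℓ)_{ab} E(M)(∂_b∂_a H) = E(M)(Dop ℓ H)` (linearity of `E(M)` over the finite sum —
every term is integrable by ✓`integrable_polyGrowth_mul_gaussian` —, `∂_b∂_a H = D²H(e_b, e_a)`, and the
symmetry of `B_ℓ` and of `C`). [folklore] -/
theorem heatSum_eq_gaussExpect_dop (blk : ι → β) (C : Matrix ι ι ℝ) (hC : C.IsHermitian) (X : Finset β)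
    {p q : β} (hp : p ∈ X) (hq : q ∈ X) (M : Matrix ι ι ℝ) (hM : M.PosDef) {H : (ι → ℝ) → ℝ}
    (hH : ContDiff ℝ (⊤ : ℕ∞) H)
    (hb : ∀ n : ℕ, ∃ (K : ℝ) (m : ℕ), ∀ φ : ι → ℝ, ‖iteratedFDeriv ℝ n H φ‖ ≤ K * (1 + ∑ i, φ i ^ 2) ^ m) :
    (1 / 2 : ℝ) * ∑ a : ι, ∑ b : ι,
        ((if blk a = blk b then 0 else if blk a ∈ X ∧ blk b ∈ X
          then (if s(blk a, blk b) = s(p, q) then (1 : ℝ) else 0) else 0) * C a b) *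
        ((∫ φ : ι → ℝ, fderiv ℝ (fun φ : ι → ℝ => fderiv ℝ H φ (Pi.single a 1)) φ (Pi.single b 1)
            * Real.exp (-(φ ⬝ᵥ (M⁻¹ *ᵥ φ)) / 2))
          / ∫ φ : ι → ℝ, Real.exp (-(φ ⬝ᵥ (M⁻¹ *ᵥ φ)) / 2))
      = (∫ φ : ι → ℝ, ((1 / 2 : ℝ) * ∑ x : ι, ∑ y : ι,
            if s(blk x, blk y) = s(p, q) ∧ blk x ≠ blk y
              then C x y * iteratedFDeriv ℝ 2 H φ ![Pi.single x 1, Pi.single y 1] else 0)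
          * Real.exp (-(φ ⬝ᵥ (M⁻¹ *ᵥ φ)) / 2))
        / ∫ φ : ι → ℝ, Real.exp (-(φ ⬝ᵥ (M⁻¹ *ᵥ φ)) / 2) := by
  -- notation
  set w : (ι → ℝ) → ℝ := fun φ => Real.exp (-(φ ⬝ᵥ (M⁻¹ *ᵥ φ)) / 2) with hw
  set Z : ℝ := ∫ φ : ι → ℝ, w φ with hZ
  set T : ι → ι → (ι → ℝ) → ℝ := fun x y φ =>
    iteratedFDeriv ℝ 2 H φ ![Pi.single x 1, Pi.single y 1] with hT
  set c : ι → ι → ℝ := fun x y => if s(blk x, blk y) = s(p, q) ∧ blk x ≠ blk y then C x y else 0 with hc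
  -- integrability of every term
  obtain ⟨K2, m2, hK2⟩ := hb 2
  have hTint : ∀ x y, Integrable (fun φ : ι → ℝ => T x y φ * w φ) := by
    intro x y
    refine integrable_polyGrowth_mul_gaussian ι M⁻¹ hM.inv m2 K2 (T x y) ?_ fun φ => ?_
    · have hc2 : Continuous (T x y) :=
        (continuous_eval_const (![Pi.single x 1, Pi.single y 1] : Fin 2 → ι → ℝ)).comp
          (hH.continuous_iteratedFDeriv (m := 2) (by rw [show ((2 : ℕ) : WithTop ℕ∞) = ((2 : ℕ∞) : WithTop ℕ∞) from rfl]; exact WithTop.coe_le_coe.2 le_top))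
      exact hc2.aestronglyMeasurable
    · exact (PolyGrowth.abs_iteratedFDeriv_two_single_le φ x y).trans (hK2 φ)
  -- (1) the second partials are the values of `D²H`
  have hdd : ∀ a b (φ : ι → ℝ),
      fderiv ℝ (fun φ : ι → ℝ => fderiv ℝ H φ (Pi.single a 1)) φ (Pi.single b 1) = T b a φ := by
    intro a b φ; simp only [hT]; rw [PolyGrowth.fderiv_partial_apply hH]
  -- (2) the direction-matrix coefficients are the `Dop` coefficients
  have hcoef : ∀ a b : ι, (if blk a = blk b then 0 else if blk a ∈ X ∧ blk b ∈ X
      then (if s(blk a, blk b) = s(p, q) then (1 : ℝ) else 0) else 0) * C a b = c a b := by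
    intro a b
    simp only [hc]
    by_cases h1 : blk a = blk b
    · rw [if_pos h1, if_neg (fun h => h.2 h1), zero_mul]
    · rw [if_neg h1]
      by_cases h2 : blk a ∈ X ∧ blk b ∈ X
      · rw [if_pos h2]
        by_cases h3 : s(blk a, blk b) = s(p, q)
        · rw [if_pos h3, if_pos ⟨h3, h1⟩, one_mul]
        · rw [if_neg h3, if_neg (fun h => h3 h.1), zero_mul]
      · rw [if_neg h2, zero_mul, if_neg]
        rintro ⟨h3, -⟩
        exact h2 ((dir_cond_iff blk X hp hq a b).2 ⟨h3, h1⟩).2.1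
  have hcsymm : ∀ a b : ι, c a b = c b a := by
    intro a b
    have hCs : C b a = C a b := by simpa using (hC.apply b a).symm
    simp only [hc]
    rw [show s(blk b, blk a) = s(blk a, blk b) from Sym2.eq_swap, hCs]
    simp only [ne_comm]
  -- (3) the left side, term by term
  have hL : (1 / 2 : ℝ) * ∑ a : ι, ∑ b : ι,
      ((if blk a = blk b then 0 else if blk a ∈ X ∧ blk b ∈ X
        then (if s(blk a, blk b) = s(p, q) then (1 : ℝ) else 0) else 0) * C a b) *
        ((∫ φ : ι → ℝ, fderiv ℝ (fun φ : ι → ℝ => fderiv ℝ H φ (Pi.single a 1)) φ (Pi.single b 1) * w φ) / Z)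
      = (1 / 2 : ℝ) * ∑ x : ι, ∑ y : ι, c x y * ((∫ φ : ι → ℝ, T x y φ * w φ) / Z) := by
    congr 1
    have h1 : ∀ a b : ι, (fun φ : ι → ℝ => fderiv ℝ (fun φ : ι → ℝ => fderiv ℝ H φ (Pi.single a 1)) φ
        (Pi.single b 1) * w φ) = fun φ => T b a φ * w φ := by
      intro a b; funext φ; rw [hdd]
    simp only [hcoef, h1]
    rw [Finset.sum_comm]
    exact Finset.sum_congr rfl fun x _ => Finset.sum_congr rfl fun y _ => by rw [hcsymm]
  -- (4) the right side: linearity of the integral over the finite sum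
  have hR : (∫ φ : ι → ℝ, ((1 / 2 : ℝ) * ∑ x : ι, ∑ y : ι,
        if s(blk x, blk y) = s(p, q) ∧ blk x ≠ blk y then C x y * T x y φ else 0) * w φ)
      = (1 / 2 : ℝ) * ∑ x : ι, ∑ y : ι, c x y * ∫ φ : ι → ℝ, T x y φ * w φ := by
    have hterm : ∀ x y (φ : ι → ℝ),
        (if s(blk x, blk y) = s(p, q) ∧ blk x ≠ blk y then C x y * T x y φ else 0) = c x y * T x y φ := by
      intro x y φ; simp only [hc]; split_ifs <;> simp
    simp only [hterm]
    have hint : ∀ x y, Integrable (fun φ : ι → ℝ => c x y * (T x y φ * w φ)) := fun x y =>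
      (hTint x y).const_mul _
    calc (∫ φ : ι → ℝ, ((1 / 2 : ℝ) * ∑ x : ι, ∑ y : ι, c x y * T x y φ) * w φ)
        = ∫ φ : ι → ℝ, (1 / 2 : ℝ) * ∑ x : ι, ∑ y : ι, c x y * (T x y φ * w φ) := by
          refine integral_congr_ae (Filter.Eventually.of_forall fun φ => ?_)
          simp only [Finset.sum_mul, mul_assoc]
      _ = (1 / 2 : ℝ) * ∑ x : ι, ∑ y : ι, c x y * ∫ φ : ι → ℝ, T x y φ * w φ := by
          rw [integral_const_mul, integral_finsetSum _ (fun x _ => integrable_finsetSum _ fun y _ => hint x y)]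
          congr 1
          refine Finset.sum_congr rfl fun x _ => ?_
          rw [integral_finsetSum _ (fun y _ => hint x y)]
          exact Finset.sum_congr rfl fun y _ => integral_const_mul _ _
  rw [hL, hR, mul_div_assoc, Finset.sum_div]
  congr 1
  refine Finset.sum_congr rfl fun x _ => ?_
  rw [Finset.sum_div]
  exact Finset.sum_congr rfl fun y _ => by rw [mul_div_assoc]

end Summit.QuantumFields.YangMills.Theorems.AnchorGap.LineDop
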